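import Literature.NumberTheory.Automorphic.HarishChandraFinitenessGLOne
import Literature.NumberTheory.Automorphic.LangAutomorphicFormsProofs
import HarnessLib

/-!
# Harish-Chandra's finiteness theorem for `GL₁`, character form (Borel–Jacquet 1979, 4.3 (i),
# case `n = 1`)

Topic `NumberTheory/Automorphic`. The case `n = 1` of the named fact `harishChandra_finiteness hcpt`
of `LangAutomorphicForms` (Borel–Jacquet 1979, 4.3 (i), ideal form: level `U`, ideal `J ≤ Z(𝔤)` of
finite codimension, `K_∞`-types in a finite set) is a theorem, `harishChandra_finiteness_glOne` of
`HarishChandraFinitenessGLOne`. The tree reduces the character form `harishChandra_finiteness_gl hcpt`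
of `AutomorphicRepsGL` (the same statement with `J = ker θ` for a `Z(𝔤)`-character `θ`, the
hypothesis `hfin`/`hHC` of the cuspidal admissibility files) to the ideal form for every `n`
(`harishChandra_finiteness_gl_of_harishChandra_finiteness` of `LangAutomorphicFormsProofs`), so the
character form is a theorem for `GL₁` as well: `harishChandra_finiteness_gl_glOne`. (The other
consequence recorded in the tree, admissibility of the automorphic representations of `GL₁(𝔸_K)`,
is `automorphicRep_isAdmissible_glOne` of `LangAutomorphicFormsAdmissibleGLOne`.) One-line proof; no
definition, no named fact.

## References

* A. Borel, H. Jacquet, *Automorphic forms and automorphic representations*, Proc. Sympos. Pure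
  Math. 33 (Corvallis 1977), Part 1 (1979), 189–202, 4.3 (i) [BorelJacquet1979].
-/

noncomputable section

namespace Literature.NumberTheory.Automorphic

variable {K : Type} [Field K] [NumberField K]

/-- **Harish-Chandra's finiteness theorem for `GL₁`, character form** (Borel–Jacquet 1979,
4.3 (i), `n = 1`): for every level `U`, every character `θ : Z(𝔤) →ₐ[ℝ] ℂ` and every
finite-dimensional right-`K_∞`-stable space `M` of functions on `K_∞`, the automorphic forms on
`GL₁(𝔸_K) = 𝔸_K^×` of level `U`, `Z(𝔤)`-character `θ` and `K_∞`-slices in `M` span a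
finite-dimensional space — the named fact `harishChandra_finiteness_gl hcpt` of `AutomorphicRepsGL`
at `n = 1`, from the ideal form `harishChandra_finiteness_glOne` through
`harishChandra_finiteness_gl_of_harishChandra_finiteness`. [cite: BorelJacquet1979, 4.3 (i)] -/
theorem harishChandra_finiteness_gl_glOne (hcpt : isCompact_glFiniteIntegralLevel 1 K) :
    harishChandra_finiteness_gl hcpt :=
  harishChandra_finiteness_gl_of_harishChandra_finiteness (harishChandra_finiteness_glOne hcpt)

end Literature.NumberTheory.Automorphic
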